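import Summits.Ventures.CertifiedQuantumChemistry.Rows.SingletOverlapSpinContaminatedTrial
import HarnessLib

/-!
# Rows/SingletOverlapSpinTrialTwoLowerRows.lean: singlet overlap rows from an `S_z`-SECTOR trial with the
# Eckart denominator taken from a SINGLET lower row and the spin-contamination term from the SECTOR lower row

HONEST FRAMING (verbatim): certified bounds for a stated model Hamiltonian in a stated basis; not a claim about
the real molecule or material beyond that model.

LADDER-CHEM I-TYPE (cell chem-oracle, seat chem-type-06 gen 7, offer (J″)). One-proof sibling of
`Rows/SingletOverlapSpinContaminatedTrial` (gen 6, (J′) second half: `singletOverlapLowerRow_of_singletGapCertificateCodimOne_spin`,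
`…_spin_real`, `…_spin_interval`). There the single sector lower row `ℓ` (`LowerRow F n n ℓ`) plays TWO roles: it
bounds the energy of the non-singlet part of the trial from below (the spin-contamination term `(s/2)(σ − ℓ)`) AND
it stands in for the singlet ground energy in Eckart's denominator (the slot's left side `w·N·(σ − ℓ)`), so the
certified weight pays the full slack `E₀^{S=0} − ℓ` of the sector row. Here the two roles are SPLIT: a singlet
lower row `SingletLowerRow F n ℓS` (`ℓS ≤ E₀(Ĥ_F; N = 2n, S = 0)` — e.g. chem-type-09's Temple rows on `K`,
`Rows/SingletTempleRows` / its spin-allowance sibling, or any sector row via `LowerRow.singlet`) carries the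
denominator, and the sector row `ℓ` only the contamination term. MAIN THEOREM
`singletOverlapLowerRow_of_singletGapCertificateCodimOne_spin_singletLowerRow`: symmetric `F`; chem-type-09's gap
leg `SingletGapCertificateCodimOne F n σ`; a vector `φ` of the `(n, n)` SECTOR with certified
`Re⟨φ, Ĥ(F)φ⟩ ≤ h`, `⟨φ, φ⟩ = N`, `‖Ŝ_+φ‖² ≤ s`; `LowerRow F n n ℓ` with `ℓ ≤ σ`; `SingletLowerRow F n ℓS` with
`ℓS < σ`; slot `w·N·(σ − ℓS) ≤ N·σ − h − (s/2)(σ − ℓ)` ⇒ `SingletOverlapLowerRow F n φ w` (every SINGLET ground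
state `ψ` has `|⟨φ, ψ⟩|² ≥ w·⟨φ,φ⟩·⟨ψ,ψ⟩`). The gen-6 theorems are the case `ℓS = ℓ` (`LowerRow.singlet`). Real
core `…_real` and the INTERVAL reading `…_interval` (norm enclosed, slot at both endpoints) as in the sibling; a
SHIFTED-MOMENT interval reading `…_shifted` (shift `ρ`, upper end of `Re⟨φ,(Ĥ − ρ)φ⟩` — the shape of cell
certnum's moments record, `Literature.Computation.Certificates.TempleMomentCertificate` §3); producer-agnostic
twin `…_of_forall_orthogonal_spin_singletLowerRow`. Printed source of the inequality:
Goodisman (1973) Ch. III §A.2, "`a₀² ≥ 1 − [(⟨Φ|H|Φ⟩ − E₀)/(E₁ − E₀)]`" (12), p. 93 (Eckart 1930), applied to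
the singlet projection `P_{S=0}φ ∈ K`; the split `‖φ − P_{S=0}φ‖² ≤ ‖Ŝ_+φ‖²/2` is the tree's
(`two_mul_norm_sub_singletProj_le`, `Rows/SingletUpperSpinBound` §1; Löwdin 1955). HONEST LIMITS: a statement
about SINGLET ground states of the MODEL; informative only when `Nσ − h − (s/2)(σ − ℓ) > 0`; the weight still
pays the slack `E₀^{S=0} − ℓS` of whatever singlet row is supplied; nothing here produces a number, a gap leg, a
Temple row or a claim node.
-/

noncomputable section

namespace Summit.Ventures.CertifiedQuantumChemistry

open Matrix Finset
open Literature.MathematicalPhysics.QuantumLattice Literature.MathematicalPhysics.QuantumChemistry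
open Literature.MathematicalPhysics.QuantumLattice.EigenvalueContinuation
open Literature.MathematicalPhysics.QuantumLattice.SymmetryProjection (singletProj)
open scoped ComplexOrder

variable {k : ℕ}

/-! ## §1 Splitting along the singlet projector; the un-normalised Eckart step (private, as in the sibling) -/

/-- Orthogonal splitting of the norm along a Hermitian idempotent: `⟨ψ,ψ⟩ = ⟨Pψ,Pψ⟩ + ⟨ψ−Pψ, ψ−Pψ⟩`. [folklore] -/
private theorem norm_split₂ {ι : Type*} [Fintype ι] [DecidableEq ι] {P : Matrix ι ι ℂ} (hP : Pᴴ = P)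
    (hPP : P * P = P) (ψ : ι → ℂ) :
    star ψ ⬝ᵥ ψ = star (P *ᵥ ψ) ⬝ᵥ (P *ᵥ ψ) + star (ψ - P *ᵥ ψ) ⬝ᵥ (ψ - P *ᵥ ψ) := by
  have h1 : star (P *ᵥ ψ) ⬝ᵥ (P *ᵥ ψ) = star ψ ⬝ᵥ (P *ᵥ ψ) := by
    rw [star_mulVec, hP, ← dotProduct_mulVec, mulVec_mulVec, hPP]
  have h2 : star (P *ᵥ ψ) ⬝ᵥ ψ = star ψ ⬝ᵥ (P *ᵥ ψ) := by
    rw [star_mulVec, hP, ← dotProduct_mulVec]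
  rw [star_sub, sub_dotProduct, dotProduct_sub, dotProduct_sub, h1, h2]
  ring

/-- Splitting of an expectation along a Hermitian idempotent commuting with `A`:
`⟨ψ,Aψ⟩ = ⟨Pψ, A Pψ⟩ + ⟨ψ−Pψ, A(ψ−Pψ)⟩`. [folklore] -/
private theorem expect_split₂ {ι : Type*} [Fintype ι] [DecidableEq ι] {P A : Matrix ι ι ℂ} (hP : Pᴴ = P)
    (hPP : P * P = P) (hPA : Commute P A) (ψ : ι → ℂ) :
    star ψ ⬝ᵥ (A *ᵥ ψ) =
      star (P *ᵥ ψ) ⬝ᵥ (A *ᵥ (P *ᵥ ψ)) + star (ψ - P *ᵥ ψ) ⬝ᵥ (A *ᵥ (ψ - P *ᵥ ψ)) := by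
  have hAP : A * P = P * A := hPA.eq.symm
  have h1 : star (P *ᵥ ψ) ⬝ᵥ (A *ᵥ (P *ᵥ ψ)) = star ψ ⬝ᵥ ((A * P) *ᵥ ψ) := by
    rw [star_mulVec, hP, ← dotProduct_mulVec, mulVec_mulVec, mulVec_mulVec, ← hAP, Matrix.mul_assoc, hPP]
  have h2 : star (P *ᵥ ψ) ⬝ᵥ (A *ᵥ ψ) = star ψ ⬝ᵥ ((A * P) *ᵥ ψ) := by
    rw [star_mulVec, hP, ← dotProduct_mulVec, mulVec_mulVec, hAP]
  have h3 : star ψ ⬝ᵥ (A *ᵥ (P *ᵥ ψ)) = star ψ ⬝ᵥ ((A * P) *ᵥ ψ) := by rw [mulVec_mulVec]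
  rw [star_sub, sub_dotProduct, mulVec_sub, dotProduct_sub, dotProduct_sub, h1, h2, h3]
  ring

/-- **Un-normalised Eckart step on a subspace.** For Hermitian `A`, a UNIT eigenvector `ψ ∈ K` (`Aψ = eψ`) with the
form bound `σ‖z‖² ≤ Re⟨z, Az⟩` on `K ∩ ψ^⊥`, and ANY `y ∈ K`:
`(σ − e)(⟨y, y⟩ − |⟨ψ, y⟩|²) ≤ Re⟨y, Ay⟩ − e⟨y, y⟩` (split `y = ⟨ψ,y⟩ψ + z`; `TempleKato.norm_energy_pair`).
Saad (1992) Ch. III, proof of Thm 3.9, as in the tree's `TempleKato.sin_sq_mul_gap_le`.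
[cite: Saad1992, Ch. III §3.2 Thm 3.9] -/
private theorem eckart_unnormalised₂ {ι : Type*} [Fintype ι] [DecidableEq ι] {A : Matrix ι ι ℂ}
    {K : Submodule ℂ (ι → ℂ)} {σ e : ℝ} {ψ : ι → ℂ} (hA : Aᴴ = A) (hψ1 : star ψ ⬝ᵥ ψ = 1)
    (hAψ : A *ᵥ ψ = (e : ℂ) • ψ) (hψK : ψ ∈ K)
    (hgap : ∀ z ∈ K, star ψ ⬝ᵥ z = 0 → σ * (star z ⬝ᵥ z).re ≤ (star z ⬝ᵥ A *ᵥ z).re)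
    {y : ι → ℂ} (hyK : y ∈ K) :
    (σ - e) * ((star y ⬝ᵥ y).re - ‖star ψ ⬝ᵥ y‖ ^ 2) ≤ (star y ⬝ᵥ A *ᵥ y).re - e * (star y ⬝ᵥ y).re := by
  obtain ⟨hz, hsplit⟩ := TempleKato.orth_split hψ1 y
  set α : ℂ := star ψ ⬝ᵥ y
  set z : ι → ℂ := y - α • ψ
  have hzK : z ∈ K := K.sub_mem hyK (K.smul_mem _ hψK)
  obtain ⟨hn, hE⟩ := TempleKato.norm_energy_pair hA hAψ hz α 1
  rw [← hsplit] at hn hE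
  simp only [hψ1, Complex.one_re, mul_one, norm_one, one_pow, one_mul] at hn hE
  have hpn := hgap z hzK hz
  rw [hn, hE]
  nlinarith [hpn]

/-- `|⟨cψ, φ⟩|² = c²|⟨ψ, φ⟩|²` for a real scalar `c`. [folklore] -/
private theorem norm_sq_star_smul_dotProduct₂ (c : ℝ) (ψ φ : Fock (Orb (Fin k))) :
    ‖star ((c : ℂ) • ψ) ⬝ᵥ φ‖ ^ 2 = c * c * ‖star ψ ⬝ᵥ φ‖ ^ 2 := by
  rw [star_smul, smul_dotProduct, smul_eq_mul, norm_mul, Complex.star_def, Complex.conj_ofReal,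
    Complex.norm_real, Real.norm_eq_abs, mul_pow, sq_abs]
  ring

/-! ## §2 The row from an `S_z`-sector trial, Eckart denominator from a SINGLET lower row -/

/-- **Real-parameter core, two lower rows.** For a symmetric file `F`: a codimension-one gap leg on the singlet
sector `SingletGapCertificateCodimOne F n σ` (chem-type-09); an explicit vector `φ` of the `(n, n)` SECTOR — not
necessarily a singlet — with real bounds `Re⟨φ, Ĥ(F)φ⟩ ≤ h` and `‖Ŝ_+φ‖² ≤ s`; a SECTOR lower row
`LowerRow F n n ℓ` with `ℓ ≤ σ` (it bounds the energy of the non-singlet part `φ − P_{S=0}φ` from below); a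
SINGLET lower row `SingletLowerRow F n ℓS` with `ℓS < σ` (it bounds `E₀^{S=0}` from below in Eckart's
denominator); and the slot at the true norm `w·⟨φ,φ⟩·(σ − ℓS) ≤ ⟨φ,φ⟩·σ − h − (s/2)(σ − ℓ)`. Then
`SingletOverlapLowerRow F n φ w`: EVERY singlet ground state `ψ` has `|⟨φ, ψ⟩|² ≥ w·⟨φ,φ⟩·⟨ψ,ψ⟩`. Proof (tree
algebra): split `φ = P_{S=0}φ + φ₁`, `‖φ₁‖² ≤ s/2` (`two_mul_norm_sub_singletProj_le`), `Re⟨φ₁,Ĥφ₁⟩ ≥ ℓ‖φ₁‖²`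
(sector row), `⟨φ, ψ⟩ = ⟨Pφ, ψ⟩`; the un-normalised Eckart step on `K` at `y = Pφ` gives
`|⟨φ,ψ̂⟩|²(σ − E₀^{S=0}) ≥ σ‖Pφ‖² − Re⟨Pφ,ĤPφ⟩ ≥ ⟨φ,φ⟩σ − h − ‖φ₁‖²(σ − ℓ)`, and `E₀^{S=0} ≥ ℓS`. The sibling's
`…_spin_real` is the case `ℓS = ℓ` (`LowerRow.singlet`). "`a₀² ≥ 1 − [(⟨Φ|H|Φ⟩ − E₀)/(E₁ − E₀)]`" (12),
Goodisman (1973) Ch. III §A.2, p. 93, for the singlet projection of the trial.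
[cite: Goodisman1973, Ch. III §A.2 eqs. (10)–(12), pp. 92–93] -/
theorem singletOverlapLowerRow_of_singletGapCertificateCodimOne_spin_singletLowerRow_real {F : Model k}
    (hF : F.IsSymmetric) {n : ℕ} {σ : ℚ} (hG : SingletGapCertificateCodimOne F n σ)
    {φ : Fock (Orb (Fin k))} (hφ : IsInSector n n φ) {h s : ℝ}
    (hh : (star φ ⬝ᵥ F.hamiltonian *ᵥ φ).re ≤ h)
    (hs : (star (spinPlus *ᵥ φ) ⬝ᵥ (spinPlus *ᵥ φ)).re ≤ s)
    {ℓ : ℚ} (hL : LowerRow F n n ℓ) (hℓσ : ℓ ≤ σ)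
    {ℓS : ℚ} (hLS : SingletLowerRow F n ℓS) (hℓSσ : ℓS < σ) {w : ℚ}
    (hw : ((w : ℚ) : ℝ) * (star φ ⬝ᵥ φ).re * (((σ : ℚ) : ℝ) - ℓS) ≤
      (star φ ⬝ᵥ φ).re * σ - h - s / 2 * (((σ : ℚ) : ℝ) - ℓ)) :
    SingletOverlapLowerRow F n φ w := by
  classical
  have hn : n ≤ k := hL.range.1
  refine ⟨hn, fun ψ hψ => ?_⟩
  have hnψ : 0 ≤ (star ψ ⬝ᵥ ψ).re := re_star_dotProduct_self_nonneg ψ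
  -- the trivial case `w·N ≤ 0`
  by_cases hwN : ((w : ℚ) : ℝ) * (star φ ⬝ᵥ φ).re ≤ 0
  · have h0 : ((w : ℚ) : ℝ) * ((star φ ⬝ᵥ φ).re * (star ψ ⬝ᵥ ψ).re) ≤ 0 := by
      rw [← mul_assoc]
      exact mul_nonpos_of_nonpos_of_nonneg hwN hnψ
    exact h0.trans (by positivity)
  push Not at hwN
  -- casts of the rational data
  have hσℓ : (0 : ℝ) ≤ ((σ : ℚ) : ℝ) - ((ℓ : ℚ) : ℝ) := by
    have : ((ℓ : ℚ) : ℝ) ≤ σ := by exact_mod_cast hℓσ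
    linarith
  have hσℓS : (0 : ℝ) < ((σ : ℚ) : ℝ) - ((ℓS : ℚ) : ℝ) := by
    have : ((ℓS : ℚ) : ℝ) < σ := by exact_mod_cast hℓSσ
    linarith
  have hwN' : (0 : ℝ) < ((w : ℚ) : ℝ) * (star φ ⬝ᵥ φ).re := hwN
  have hw' := hw
  -- objects: `H`, the singlet projector `P`, the split `φ = φ₀ + φ₁`
  set H := F.hamiltonian with hHdef
  have hH : H.IsHermitian := Model.hamiltonian_isHermitian hF
  set P : Matrix (Finset (Orb (Fin k))) (Finset (Orb (Fin k))) ℂ := singletProj with hPdef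
  have hPP : P * P = P := SymmetryProjection.singletProj_mul_self
  have hPh : Pᴴ = P := SymmetryProjection.singletProj_conjTranspose
  have hHS : Commute H spinSq := molecularHamiltonian_commute_spinSq _ _ _
  have hPH : Commute P H := singletProj_commute_of_commute_spinSq hHS (by rw [hH.eq]; exact hHS)
  have hφV : φ ∈ szSector (n + n) 0 := by
    have h1 := (mem_szSector_iff_isInSector n n φ).2 hφ
    rwa [sub_self, zero_div] at h1
  set φ₀ : Fock (Orb (Fin k)) := P *ᵥ φ with hφ₀
  set φ₁ : Fock (Orb (Fin k)) := φ - P *ᵥ φ with hφ₁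
  have hφ₀V : φ₀ ∈ szSector (n + n) 0 := singletProj_mulVec_mem_szSector hφV
  have hφ₀K : φ₀ ∈ singletSector k n := by
    rw [mem_singletSector_iff, sub_self, zero_div]
    exact ⟨hφ₀V, (spin_mulVec_eq_zero_of_spinSq_mulVec_eq_zero
      (SymmetryProjection.spinSq_mulVec_singletProj_mulVec φ)).1⟩
  have hφ₁S : IsInSector n n φ₁ := by
    have h1 : φ₁ ∈ szSector (n + n) (((n : ℝ) - n) / 2) := by
      rw [sub_self, zero_div]; exact Submodule.sub_mem _ hφV hφ₀V
    exact (mem_szSector_iff_isInSector n n φ₁).1 h1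
  -- Rayleigh facts on the two parts, the contamination bound, the splittings
  have hR1 : F.energy n n * (star φ₁ ⬝ᵥ φ₁).re ≤ (star φ₁ ⬝ᵥ H *ᵥ φ₁).re :=
    sectorGroundEnergy_mul_le_re_rayleigh hH hφ₁S
  have hR0 : F.singletEnergy n * (star φ₀ ⬝ᵥ φ₀).re ≤ (star φ₀ ⬝ᵥ H *ᵥ φ₀).re :=
    minEnergyOn_mul_le_re_rayleigh hH _ hφ₀K
  have hℓE : ((ℓ : ℚ) : ℝ) ≤ F.energy n n := hL.le
  have hℓSE : ((ℓS : ℚ) : ℝ) ≤ F.singletEnergy n := hLS.le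
  have hx : 2 * (star φ₁ ⬝ᵥ φ₁).re ≤ (star (spinPlus *ᵥ φ) ⬝ᵥ (spinPlus *ᵥ φ)).re :=
    two_mul_norm_sub_singletProj_le hφV
  have hx0 : 0 ≤ (star φ₁ ⬝ᵥ φ₁).re := re_star_dotProduct_self_nonneg _
  have hn0 : 0 ≤ (star φ₀ ⬝ᵥ φ₀).re := re_star_dotProduct_self_nonneg _
  have hNs : (star φ ⬝ᵥ φ).re = (star φ₀ ⬝ᵥ φ₀).re + (star φ₁ ⬝ᵥ φ₁).re := by
    rw [norm_split₂ hPh hPP φ, Complex.add_re]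
  have hEs : (star φ ⬝ᵥ H *ᵥ φ).re = (star φ₀ ⬝ᵥ H *ᵥ φ₀).re + (star φ₁ ⬝ᵥ H *ᵥ φ₁).re := by
    rw [expect_split₂ hPh hPP hPH φ, Complex.add_re]
  have hx1 : (star φ₁ ⬝ᵥ φ₁).re * (F.energy n n - ℓ) ≥ 0 := mul_nonneg hx0 (sub_nonneg.2 hℓE)
  have hx2 : (s / 2 - (star φ₁ ⬝ᵥ φ₁).re) * (((σ : ℚ) : ℝ) - ℓ) ≥ 0 :=
    mul_nonneg (by linarith) hσℓ
  -- `E₀^{S=0} < σ` (otherwise `h ≥ σ‖φ₀‖² + ℓ‖φ₁‖² ≥ Nσ − (s/2)(σ − ℓ)`, contradicting the slot with `wN > 0`)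
  have e1 : ((σ : ℚ) : ℝ) * (star φ ⬝ᵥ φ).re =
      ((σ : ℚ) : ℝ) * (star φ₀ ⬝ᵥ φ₀).re + ((σ : ℚ) : ℝ) * (star φ₁ ⬝ᵥ φ₁).re := by
    rw [hNs, mul_add]
  have hE0σ : F.singletEnergy n < ((σ : ℚ) : ℝ) := by
    by_contra hge
    push Not at hge
    have h1 : ((σ : ℚ) : ℝ) * (star φ₀ ⬝ᵥ φ₀).re ≤ (star φ₀ ⬝ᵥ H *ᵥ φ₀).re :=
      (mul_le_mul_of_nonneg_right hge hn0).trans hR0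
    have h2 : ((w : ℚ) : ℝ) * (star φ ⬝ᵥ φ).re * (((σ : ℚ) : ℝ) - ℓS) > 0 := mul_pos hwN' hσℓS
    linarith [h1, h2, hR1, hx1, hx2, hEs, hh, hw', e1]
  -- normalise `ψ`: a unit eigenvector in `K`; the form bound transfers to `K ∩ ψ̂^⊥`
  obtain ⟨c, hc, hcc, hc1⟩ := exists_normalize hψ.2.1
  have hψ₁K : ((c : ℂ) • ψ) ∈ singletSector k n := Submodule.smul_mem _ _ hψ.1
  have hHψ := hψ.hamiltonian_mulVec hF
  have hHψ₁ : H *ᵥ ((c : ℂ) • ψ) = ((F.singletEnergy n : ℝ) : ℂ) • ((c : ℂ) • ψ) := by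
    rw [mulVec_smul, hHψ, smul_comm]
  obtain ⟨W, u, hW, hWK⟩ := hG
  have hgapψ : ∀ z ∈ singletSector k n, star ((c : ℂ) • ψ) ⬝ᵥ z = 0 →
      ((σ : ℚ) : ℝ) * (star z ⬝ᵥ z).re ≤ (star z ⬝ᵥ H *ᵥ z).re :=
    fun z hzK hz => TempleKato.gap_of_codimOne_certificate hH.eq hW hWK hψ₁K hc1 hHψ₁ hE0σ hzK hz
  have hEck := eckart_unnormalised₂ hH.eq hc1 hHψ₁ hψ₁K hgapψ hφ₀K
  -- the overlap with `φ₀ = Pφ` is the overlap with `φ`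
  have hPy : P *ᵥ ((c : ℂ) • ψ) = (c : ℂ) • ψ := singletProj_mulVec_of_mem_singletSector hψ₁K
  have hov : star ((c : ℂ) • ψ) ⬝ᵥ φ₀ = star ((c : ℂ) • ψ) ⬝ᵥ φ := by
    have e : star ((c : ℂ) • ψ) ᵥ* P = star (P *ᵥ ((c : ℂ) • ψ)) := by rw [star_mulVec, hPh]
    rw [hφ₀, dotProduct_mulVec, e, hPy]
  rw [hov] at hEck
  set t : ℝ := ‖star ((c : ℂ) • ψ) ⬝ᵥ φ‖ ^ 2 with ht
  have ht0 : 0 ≤ t := by positivity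
  have ht1 : t * (F.singletEnergy n - ℓS) ≥ 0 := mul_nonneg ht0 (sub_nonneg.2 hℓSE)
  -- the chain `t(σ − ℓS) ≥ t(σ − E₀^{S=0}) ≥ σ‖φ₀‖² − Re⟨φ₀,Ĥφ₀⟩ ≥ Nσ − h − ‖φ₁‖²(σ − ℓ) ≥ wN(σ − ℓS)`
  have hmain : ((w : ℚ) : ℝ) * (star φ ⬝ᵥ φ).re * (((σ : ℚ) : ℝ) - ℓS) ≤ t * (((σ : ℚ) : ℝ) - ℓS) := by
    linarith [hEck, ht1, hR1, hx1, hx2, hEs, hh, hw', e1]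
  have hwt : ((w : ℚ) : ℝ) * (star φ ⬝ᵥ φ).re ≤ t := le_of_mul_le_mul_right hmain hσℓS
  -- un-normalise
  rw [ht, norm_sq_star_smul_dotProduct₂] at hwt
  have hsym : ‖star ψ ⬝ᵥ φ‖ = ‖star φ ⬝ᵥ ψ‖ := by rw [star_dotProduct, norm_star]
  rw [hsym] at hwt
  calc ((w : ℚ) : ℝ) * ((star φ ⬝ᵥ φ).re * (star ψ ⬝ᵥ ψ).re)
      = (((w : ℚ) : ℝ) * (star φ ⬝ᵥ φ).re) * (star ψ ⬝ᵥ ψ).re := by ring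
    _ ≤ (c * c * ‖star φ ⬝ᵥ ψ‖ ^ 2) * (star ψ ⬝ᵥ ψ).re := mul_le_mul_of_nonneg_right hwt hnψ
    _ = (c * c * (star ψ ⬝ᵥ ψ).re) * ‖star φ ⬝ᵥ ψ‖ ^ 2 := by ring
    _ = ‖star φ ⬝ᵥ ψ‖ ^ 2 := by rw [hcc, one_mul]

/-- **SINGLET OVERLAP ROW FROM AN `S_z`-SECTOR TRIAL, ECKART DENOMINATOR FROM A SINGLET LOWER ROW** (rational data,
the shape the cell's records deliver). Symmetric `F`; `SingletGapCertificateCodimOne F n σ`; a sector vector `φ`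
with three certified rationals `Re⟨φ, Ĥ(F)φ⟩ ≤ h`, `⟨φ, φ⟩ = N`, `‖Ŝ_+φ‖² ≤ s`; a sector lower row
`LowerRow F n n ℓ` with `ℓ ≤ σ`; a singlet lower row `SingletLowerRow F n ℓS` with `ℓS < σ`; a rational slot
`w·N·(σ − ℓS) ≤ N·σ − h − (s/2)(σ − ℓ)` ⇒ `SingletOverlapLowerRow F n φ w`. With `ℓS = ℓ` this is the sibling's
`singletOverlapLowerRow_of_singletGapCertificateCodimOne_spin`; with `s = 0`, `h = ρN` it is the pure test
`w(σ − ℓS) ≤ σ − ρ` of "`a₀² ≥ 1 − [(⟨Φ|H|Φ⟩ − E₀)/(E₁ − E₀)]`" (12), Goodisman (1973) Ch. III §A.2, p. 93.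
[cite: Goodisman1973, Ch. III §A.2 eqs. (10)–(12), pp. 92–93] -/
theorem singletOverlapLowerRow_of_singletGapCertificateCodimOne_spin_singletLowerRow {F : Model k}
    (hF : F.IsSymmetric) {n : ℕ} {σ : ℚ} (hG : SingletGapCertificateCodimOne F n σ)
    {φ : Fock (Orb (Fin k))} (hφ : IsInSector n n φ) {h N s : ℚ}
    (hh : (star φ ⬝ᵥ F.hamiltonian *ᵥ φ).re ≤ ((h : ℚ) : ℝ))
    (hN : (star φ ⬝ᵥ φ).re = ((N : ℚ) : ℝ))
    (hs : (star (spinPlus *ᵥ φ) ⬝ᵥ (spinPlus *ᵥ φ)).re ≤ ((s : ℚ) : ℝ))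
    {ℓ : ℚ} (hL : LowerRow F n n ℓ) (hℓσ : ℓ ≤ σ)
    {ℓS : ℚ} (hLS : SingletLowerRow F n ℓS) (hℓSσ : ℓS < σ) {w : ℚ}
    (hw : w * N * (σ - ℓS) ≤ N * σ - h - s / 2 * (σ - ℓ)) :
    SingletOverlapLowerRow F n φ w := by
  refine singletOverlapLowerRow_of_singletGapCertificateCodimOne_spin_singletLowerRow_real hF hG hφ hh hs
    hL hℓσ hLS hℓSσ ?_
  have hw' : ((w : ℚ) : ℝ) * N * (((σ : ℚ) : ℝ) - ℓS) ≤
      ((N : ℚ) : ℝ) * σ - h - ((s : ℚ) : ℝ) / 2 * (((σ : ℚ) : ℝ) - ℓ) := by exact_mod_cast hw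
  rw [hN]
  exact hw'

/-- **PRODUCER-AGNOSTIC form** (HYPOTHESES-M1OS (G) literally as the hypothesis): an explicit `v` with
«`∀ x ∈ singletSector k n, ⟨v, x⟩ = 0 → σ‖x‖² ≤ Re⟨x, Ĥ(F)x⟩`» in place of the gap leg (chem-type-09's
`singletGapCertificateCodimOne_of_forall_orthogonal'`), everything else as in
`singletOverlapLowerRow_of_singletGapCertificateCodimOne_spin_singletLowerRow`.
[cite: Goodisman1973, Ch. III §A.2 eqs. (10)–(12), pp. 92–93] -/
theorem singletOverlapLowerRow_of_forall_orthogonal_spin_singletLowerRow {F : Model k} (hF : F.IsSymmetric)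
    {n : ℕ} {σ : ℚ} (v : Fock (Orb (Fin k)))
    (hgap : ∀ x ∈ singletSector k n, star v ⬝ᵥ x = 0 →
      ((σ : ℚ) : ℝ) * (star x ⬝ᵥ x).re ≤ (star x ⬝ᵥ F.hamiltonian *ᵥ x).re)
    {φ : Fock (Orb (Fin k))} (hφ : IsInSector n n φ) {h N s : ℚ}
    (hh : (star φ ⬝ᵥ F.hamiltonian *ᵥ φ).re ≤ ((h : ℚ) : ℝ))
    (hN : (star φ ⬝ᵥ φ).re = ((N : ℚ) : ℝ))
    (hs : (star (spinPlus *ᵥ φ) ⬝ᵥ (spinPlus *ᵥ φ)).re ≤ ((s : ℚ) : ℝ))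
    {ℓ : ℚ} (hL : LowerRow F n n ℓ) (hℓσ : ℓ ≤ σ)
    {ℓS : ℚ} (hLS : SingletLowerRow F n ℓS) (hℓSσ : ℓS < σ) {w : ℚ}
    (hw : w * N * (σ - ℓS) ≤ N * σ - h - s / 2 * (σ - ℓ)) :
    SingletOverlapLowerRow F n φ w :=
  singletOverlapLowerRow_of_singletGapCertificateCodimOne_spin_singletLowerRow hF
    (singletGapCertificateCodimOne_of_forall_orthogonal' F v hgap) hφ hh hN hs hL hℓσ hLS hℓSσ hw

/-! ## §3 The INTERVAL reading (qc-upper-v0 / certified-fp records ENCLOSE `⟨φ,φ⟩`, `⟨φ,Ĥφ⟩`, `‖Ŝ_+φ‖²`) -/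

/-- **INTERVAL READING, two lower rows.** Symmetric `F`; `SingletGapCertificateCodimOne F n σ`; a sector vector
`φ` with certified rational ENCLOSURES `Re⟨φ, Ĥ(F)φ⟩ ≤ h`, `Nlo ≤ ⟨φ, φ⟩ ≤ Nhi`, `‖Ŝ_+φ‖² ≤ s`; a sector lower
row `ℓ ≤ σ`; a singlet lower row `ℓS < σ`; and the slot test AT BOTH NORM ENDPOINTS,
`w·N·(σ − ℓS) ≤ N·σ − h − (s/2)(σ − ℓ)` for `N = Nlo` and `N = Nhi` (affine in `N`, so it then holds at the
true norm) ⇒ `SingletOverlapLowerRow F n φ w`. [cite: Goodisman1973, Ch. III §A.2 eqs. (10)–(12), pp. 92–93] -/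
theorem singletOverlapLowerRow_of_singletGapCertificateCodimOne_spin_singletLowerRow_interval {F : Model k}
    (hF : F.IsSymmetric) {n : ℕ} {σ : ℚ} (hG : SingletGapCertificateCodimOne F n σ)
    {φ : Fock (Orb (Fin k))} (hφ : IsInSector n n φ) {h Nlo Nhi s : ℚ}
    (hh : (star φ ⬝ᵥ F.hamiltonian *ᵥ φ).re ≤ ((h : ℚ) : ℝ))
    (hNlo : ((Nlo : ℚ) : ℝ) ≤ (star φ ⬝ᵥ φ).re) (hNhi : (star φ ⬝ᵥ φ).re ≤ ((Nhi : ℚ) : ℝ))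
    (hs : (star (spinPlus *ᵥ φ) ⬝ᵥ (spinPlus *ᵥ φ)).re ≤ ((s : ℚ) : ℝ))
    {ℓ : ℚ} (hL : LowerRow F n n ℓ) (hℓσ : ℓ ≤ σ)
    {ℓS : ℚ} (hLS : SingletLowerRow F n ℓS) (hℓSσ : ℓS < σ) {w : ℚ}
    (hwlo : w * Nlo * (σ - ℓS) ≤ Nlo * σ - h - s / 2 * (σ - ℓ))
    (hwhi : w * Nhi * (σ - ℓS) ≤ Nhi * σ - h - s / 2 * (σ - ℓ)) :
    SingletOverlapLowerRow F n φ w := by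
  refine singletOverlapLowerRow_of_singletGapCertificateCodimOne_spin_singletLowerRow_real hF hG hφ hh hs
    hL hℓσ hLS hℓSσ ?_
  have hwlo' : ((w : ℚ) : ℝ) * Nlo * (((σ : ℚ) : ℝ) - ℓS) ≤
      ((Nlo : ℚ) : ℝ) * σ - h - ((s : ℚ) : ℝ) / 2 * (((σ : ℚ) : ℝ) - ℓ) := by exact_mod_cast hwlo
  have hwhi' : ((w : ℚ) : ℝ) * Nhi * (((σ : ℚ) : ℝ) - ℓS) ≤
      ((Nhi : ℚ) : ℝ) * σ - h - ((s : ℚ) : ℝ) / 2 * (((σ : ℚ) : ℝ) - ℓ) := by exact_mod_cast hwhi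
  set c : ℝ := ((σ : ℚ) : ℝ) - ((w : ℚ) : ℝ) * (((σ : ℚ) : ℝ) - ℓS) with hc
  rcases le_or_gt 0 c with hc0 | hc0
  · have hm : 0 ≤ ((star φ ⬝ᵥ φ).re - Nlo) * c := mul_nonneg (sub_nonneg.2 hNlo) hc0
    rw [hc] at hm
    linarith
  · have hm : 0 ≤ (((Nhi : ℚ) : ℝ) - (star φ ⬝ᵥ φ).re) * (-c) :=
      mul_nonneg (sub_nonneg.2 hNhi) (neg_nonneg.2 hc0.le)
    rw [hc] at hm
    linarith

/-- **SHIFTED-MOMENT INTERVAL READING** (the shape a shifted-contraction moments record delivers — cell certnum's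
`Literature.Computation.Certificates.TempleMomentCertificate` §3 matrix reading: a dyadic shift `ρ`, enclosures
`Nlo ≤ ⟨φ, φ⟩ ≤ Nhi`, the UPPER end `ahi` of the SHIFTED first moment `Re⟨φ, Ĥ(F)φ⟩ − ρ·⟨φ, φ⟩`
(`= Re⟨φ, (Ĥ − ρ)φ⟩`, their `re_shifted_first_moment`), and `‖Ŝ_+φ‖² ≤ s`). With the gap leg, the two lower
rows (`ℓ ≤ σ` sector, `ℓS < σ` singlet) and the slot in shifted variables AT BOTH NORM ENDPOINTS,
`w·N·(σ − ℓS) ≤ N·(σ − ρ) − ahi − (s/2)(σ − ℓ)` for `N = Nlo` and `N = Nhi` (affine in `N`) ⇒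
`SingletOverlapLowerRow F n φ w` (the real core at `h = Re⟨φ, Ĥφ⟩ ≤ ahi + ρ·⟨φ,φ⟩`).
[cite: Goodisman1973, Ch. III §A.2 eqs. (10)–(12), pp. 92–93] -/
theorem singletOverlapLowerRow_of_singletGapCertificateCodimOne_spin_singletLowerRow_shifted {F : Model k}
    (hF : F.IsSymmetric) {n : ℕ} {σ : ℚ} (hG : SingletGapCertificateCodimOne F n σ)
    {φ : Fock (Orb (Fin k))} (hφ : IsInSector n n φ) {ρ ahi Nlo Nhi s : ℚ}
    (hahi : (star φ ⬝ᵥ F.hamiltonian *ᵥ φ).re - ((ρ : ℚ) : ℝ) * (star φ ⬝ᵥ φ).re ≤ ((ahi : ℚ) : ℝ))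
    (hNlo : ((Nlo : ℚ) : ℝ) ≤ (star φ ⬝ᵥ φ).re) (hNhi : (star φ ⬝ᵥ φ).re ≤ ((Nhi : ℚ) : ℝ))
    (hs : (star (spinPlus *ᵥ φ) ⬝ᵥ (spinPlus *ᵥ φ)).re ≤ ((s : ℚ) : ℝ))
    {ℓ : ℚ} (hL : LowerRow F n n ℓ) (hℓσ : ℓ ≤ σ)
    {ℓS : ℚ} (hLS : SingletLowerRow F n ℓS) (hℓSσ : ℓS < σ) {w : ℚ}
    (hwlo : w * Nlo * (σ - ℓS) ≤ Nlo * (σ - ρ) - ahi - s / 2 * (σ - ℓ))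
    (hwhi : w * Nhi * (σ - ℓS) ≤ Nhi * (σ - ρ) - ahi - s / 2 * (σ - ℓ)) :
    SingletOverlapLowerRow F n φ w := by
  refine singletOverlapLowerRow_of_singletGapCertificateCodimOne_spin_singletLowerRow_real hF hG hφ le_rfl hs
    hL hℓσ hLS hℓSσ ?_
  have hwlo' : ((w : ℚ) : ℝ) * Nlo * (((σ : ℚ) : ℝ) - ℓS) ≤
      ((Nlo : ℚ) : ℝ) * (((σ : ℚ) : ℝ) - ρ) - ahi - ((s : ℚ) : ℝ) / 2 * (((σ : ℚ) : ℝ) - ℓ) := by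
    exact_mod_cast hwlo
  have hwhi' : ((w : ℚ) : ℝ) * Nhi * (((σ : ℚ) : ℝ) - ℓS) ≤
      ((Nhi : ℚ) : ℝ) * (((σ : ℚ) : ℝ) - ρ) - ahi - ((s : ℚ) : ℝ) / 2 * (((σ : ℚ) : ℝ) - ℓ) := by
    exact_mod_cast hwhi
  set c : ℝ := (((σ : ℚ) : ℝ) - ρ) - ((w : ℚ) : ℝ) * (((σ : ℚ) : ℝ) - ℓS) with hc
  rcases le_or_gt 0 c with hc0 | hc0
  · have hm : 0 ≤ ((star φ ⬝ᵥ φ).re - Nlo) * c := mul_nonneg (sub_nonneg.2 hNlo) hc0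
    rw [hc] at hm
    linarith
  · have hm : 0 ≤ (((Nhi : ℚ) : ℝ) - (star φ ⬝ᵥ φ).re) * (-c) :=
      mul_nonneg (sub_nonneg.2 hNhi) (neg_nonneg.2 hc0.le)
    rw [hc] at hm
    linarith

-- Consistency (checked at drafting, not re-declared — the gate's dedup lint forbids restating a landed theorem):
-- the sibling's `singletOverlapLowerRow_of_singletGapCertificateCodimOne_spin` (one sector row `ℓ < σ`) is the term
-- `…_spin_singletLowerRow hF hG hφ hh hN hs hL hℓσ.le (hL.singlet hF) hℓσ hw` (`LowerRow.singlet`, Rows/SingletRows).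

end Summit.Ventures.CertifiedQuantumChemistry

end
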